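import Summits.HubbardSuperconductivity.HubbardSuperconductivity.Theses.InfiniteVolumeFirst
import Summits.HubbardSuperconductivity.HubbardSuperconductivity.Theses.KacWindowPenalty
import HarnessLib

/-!
# Crux `NoInfraredPileUp` (stmt-HubbardSuperconductivity-18534, route `InfiniteVolumeFirst`) —
# the bookkeeping edge from route `KacWindowPenalty`'s linear window infrared bound

`KacWindowPenalty.WindowInfraredBound` (stmt-HubbardSuperconductivity-1089: for EVERY `U > 0` and
`δ ∈ (0,1/2)` there are `C, ε₀, L₀` with `Σ_{m ≠ 0, |q_m| ≤ ε} S_ψ(m) ≤ C ε L²` for every normalised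
`(2⌊(1-δ)L²/2⌋, 0)`-sector ground state, every `ε ∈ (0, ε₀]` and every even `L ≥ L₀`) is the
LINEAR-RATE, all-coupling strengthening of the soft weak-coupling tightness crux `NoInfraredPileUp`
(`∀ δ ∃ U₁ ∀ U ∈ (0,U₁) ∀` admissible families `∀ η ∃ ε, L₀`: the same window sum is `≤ η L²`).
Here the implication is kernel-checked (`stub_noInfraredPileUp_of_windowInfraredBound`): take
`U₁ := 1` and, given `η > 0` and the data `C, ε₀, L₀` of the bound at `(U, δ)`, the window
`ε := min ε₀ (η / (C + 1))`, so that `C ε ≤ C η/(C+1) ≤ η`. The `let`-bound Fourier mode of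
stmt-1089 is `pairFieldAt dWaveFormFactor L m` and its summand is `pairStructureFactor` by `rfl`
(`PairFieldMomentum.lean`), and its explicit Brillouin-zone norm is `momentumNormSq L m` by `rfl`.
So a proof of stmt-1089 closes stmt-18534 (the converse is not claimed: the crux has no rate and is
restricted to weak coupling). Source of the observation: the refuter's crux-attack at birth
(rattack-18534, `Glue.lean`, 2026-08-17), whose file is not importable; re-proved here.

No definition and no named fact is introduced.
-/

-- the mandated namespace `Summit.<Summit>.<Problem>.Theorems` repeats `HubbardSuperconductivity`
-- (single-problem summit, D-0017), which the `dupNamespace` linter flags on every declaration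
set_option linter.dupNamespace false

namespace Summit.HubbardSuperconductivity.HubbardSuperconductivity.Theorems.NoInfraredPileUp

open Summit.HubbardSuperconductivity.HubbardSuperconductivity.Theses
open Literature.MathematicalPhysics.QuantumLattice Literature.Probability.LatticeModels Matrix Finset

/-- **stmt-1089 ⇒ stmt-18534.** The linear window infrared bound of route `KacWindowPenalty`
(`Σ_{m≠0,|q_m|≤ε} S_ψ(m) ≤ C ε L²` for every sector ground state, all `U > 0`, `δ ∈ (0,1/2)`,
`ε ≤ ε₀`, even `L ≥ L₀`) implies the soft weak-coupling tightness crux `NoInfraredPileUp` of route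
`InfiniteVolumeFirst`, with `U₁ := 1` and `ε := min ε₀ (η/(C+1))`. [folklore] -/
theorem stub_noInfraredPileUp_of_windowInfraredBound :
    Summit.HubbardSuperconductivity.HubbardSuperconductivity.Theses.KacWindowPenalty.WindowInfraredBound →
      Summit.HubbardSuperconductivity.HubbardSuperconductivity.Theses.InfiniteVolumeFirst.NoInfraredPileUp := by
  intro h δ hδ
  refine ⟨1, one_pos, fun U hU N ψ hadm η hη => ?_⟩
  obtain ⟨C, ε₀, hC, hε₀, L₀, hL₀⟩ := h U hU.1 δ hδ
  have hC1 : 0 < C + 1 := by linarith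
  have hεpos : 0 < min ε₀ (η / (C + 1)) := lt_min hε₀ (div_pos hη hC1)
  refine ⟨min ε₀ (η / (C + 1)), hεpos, L₀, fun L _ hL hLL => ?_⟩
  have hadmL := hadm L hL
  have hgs : IsGroundStateInSector (hubbardTorus 2 L 1 U) (2 * ⌊(1 - δ) * (L : ℝ) ^ 2 / 2⌋₊) 0
      (ψ L) := hadmL.1 ▸ hadmL.2.2
  have key := hL₀ _ ⟨hεpos, min_le_left _ _⟩ L hLL hL (ψ L) hadmL.2.1 hgs
  have hCε : C * min ε₀ (η / (C + 1)) * (L : ℝ) ^ 2 ≤ η * (L : ℝ) ^ 2 := by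
    refine mul_le_mul_of_nonneg_right ?_ (sq_nonneg _)
    calc C * min ε₀ (η / (C + 1)) ≤ C * (η / (C + 1)) :=
          mul_le_mul_of_nonneg_left (min_le_right _ _) hC
      _ ≤ (C + 1) * (η / (C + 1)) :=
          mul_le_mul_of_nonneg_right (by linarith) (div_pos hη hC1).le
      _ = η := by field_simp
  exact le_trans key hCε

end Summit.HubbardSuperconductivity.HubbardSuperconductivity.Theorems.NoInfraredPileUp
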